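import Literature.NumberTheory.EllipticCurves.CuspFormLDerivativeSeries
import HarnessLib

/-!
# The Buhler–Gross–Zagier series for `Λ‴(f, 1)` (Cremona 1997, (2.13.1) with `r = 3`)

Topic `NumberTheory/EllipticCurves`, namespace `Literature.NumberTheory.EllipticCurves.ModularForms`
(companion of `CuspFormLDerivativeSeries`, the case `r = 1`).

For a cusp form `f = ∑ aₙ qⁿ ∈ S₂(Γ₀(N))` with `w_N f = f` (root number `-1`, odd order of
vanishing at `s = 1`) and `Λ` the entire continuation of `Λ_N(f, s) = N^{s/2} (2π)^{-s} Γ(s) L(f, s)`: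

* `Λ‴(f, 1) = 2 ∫_1^∞ f(iy/√N) (log y)³ dy` ([CremonaAlgorithms1997], §2.13:
  "`Λ^{(k)}(f, 1) = (1 - (-1)^k ε) ∫_1^∞ f(iy/√N) (log y)^k dy`", `k = 3`, `ε = +1`), theorem
  `iteratedDeriv_three_completedCuspFormL_continuation_one_eq_integral`;
* `Λ‴(f, 1) = 2 ∑_{n ≥ 1} aₙ ∫_1^∞ e^{-2πny/√N} (log y)³ dy` ([CremonaAlgorithms1997], (2.13.1) with
  `r = 3`; the method of Buhler–Gross–Zagier 1985, §3 (11)–(13)), theorem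
  `hasSum_iteratedDeriv_three_completedCuspFormL_continuation_one_integral`.

Printed proof ([CremonaAlgorithms1997], §2.13, PDF pp. 35–36) followed here: with `F(y) = f(iy/√N)`
one has `Λ(f, s) = ∫_0^∞ F(y) y^{s-1} dy` (2.8.5) — in the tree `Λ` is Hecke's
`N^{s/2} ∫_0^∞ f(it) t^{s-1} dt` (`cpow_mul_mellin_mem_completedCuspFormLContinuations_two`), which is
the Mellin transform of the rescaled `F` (`mellin_comp_mul_left`); "differentiating `k` times with
respect to `s`" is three applications of Mathlib's `mellin_hasDerivAt_of_isBigO_rpow` (the weights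
`log^j` preserve the decay of `F` at `0` and `∞`, Mathlib `isBigO_rpow_top_log_smul`,
`isBigO_rpow_zero_log_smul`), giving `Λ‴(1) = ∫_0^∞ F(y) (log y)³ dy`; "using
`f(-1/Nz) = ε N z² f(z)`", i.e. `F(1/y) = -y² F(y)` for `ε = +1`, the piece over `(0, 1]` equals the
piece over `[1, ∞)` (the weight `(log y)³` is odd under `y ↦ 1/y`, tree lemma
`setIntegral_Ioc_eq_of_flip`), whence the factor `2 = 1 - (-1)³ ε`; finally termwise integration of
the `q`-expansion, dominated by `∑ ‖aₙ‖ · 96 e^{-πn/√N}/(2πn/√N)⁴ < ∞`.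

Everything here is proved; no definition and no named fact is introduced (D-0026). Motivation: the
case `r = 3` is Buhler–Gross–Zagier's computation of `L‴(E, 1)` for the rank-`3` curve `5077a`
(their (14)), the input «`ord_{s=1} L(E, s) ≤ 3`» of Goldfeld's effective class-number bound.

## References

* [CremonaAlgorithms1997] J. E. Cremona, *Algorithms for Modular Elliptic Curves*, 2nd ed., CUP
  1997, §2.13, (2.13.1), Prop. 2.13.1 (held: `book:cremona1997-algorithms-modular-elliptic-curves-2nd-ed`,
  PDF pp. 35–36).
* [BuhlerGrossZagier1985] J. P. Buhler, B. H. Gross, D. B. Zagier, *On the conjecture of Birch and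
  Swinnerton-Dyer for an elliptic curve of rank 3*, Math. Comp. 44 (1985), 473–481, §3 (11)–(13).
-/

noncomputable section

open scoped MatrixGroups ModularForm Manifold

open CongruenceSubgroup UpperHalfPlane Complex Filter Topology Asymptotics Set MeasureTheory Real

namespace Literature.NumberTheory.EllipticCurves.ModularForms

/-! ### Mellin transforms of rapidly decaying functions: derivatives of all orders -/

/-- The decay class "continuous on `(0, ∞)`, `O(t^{-a})` at `∞` and at `0⁺` for every `a`" is stable
under the weight `log t` (Mathlib `isBigO_rpow_top_log_smul`, `isBigO_rpow_zero_log_smul`); this is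
what makes "differentiating `k` times" under the Mellin integral legitimate.
[cite: CremonaAlgorithms1997, §2.13] -/
theorem decay_log_smul {g : ℝ → ℂ} (hg : ContinuousOn g (Ioi 0))
    (htop : ∀ a : ℝ, g =O[atTop] (· ^ (-a))) (hbot : ∀ b : ℝ, g =O[𝓝[>] 0] (· ^ (-b))) :
    ContinuousOn (fun t : ℝ ↦ Real.log t • g t) (Ioi 0) ∧
      (∀ a : ℝ, (fun t : ℝ ↦ Real.log t • g t) =O[atTop] (· ^ (-a))) ∧
      (∀ b : ℝ, (fun t : ℝ ↦ Real.log t • g t) =O[𝓝[>] 0] (· ^ (-b))) := by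
  refine ⟨?_, fun a ↦ isBigO_rpow_top_log_smul (lt_add_one a) (htop (a + 1)),
    fun b ↦ isBigO_rpow_zero_log_smul (sub_one_lt b) (hbot (b - 1))⟩
  exact (Real.continuousOn_log.mono fun t ht ↦ ne_of_gt (mem_Ioi.mp ht)).smul hg

/-- **Differentiation under the Mellin integral** in the decay class: for every `s`,
`d/ds ∫_0^∞ g(t) t^{s-1} dt = ∫_0^∞ g(t) (log t) t^{s-1} dt`, the latter convergent (Mathlib
`mellin_hasDerivAt_of_isBigO_rpow`). [cite: CremonaAlgorithms1997, §2.13] -/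
theorem hasDerivAt_mellin_of_decay {g : ℝ → ℂ} (hg : ContinuousOn g (Ioi 0))
    (htop : ∀ a : ℝ, g =O[atTop] (· ^ (-a))) (hbot : ∀ b : ℝ, g =O[𝓝[>] 0] (· ^ (-b)))
    (s : ℂ) :
    MellinConvergent (fun t : ℝ ↦ Real.log t • g t) s ∧
      HasDerivAt (mellin g) (mellin (fun t : ℝ ↦ Real.log t • g t) s) s :=
  mellin_hasDerivAt_of_isBigO_rpow (hg.locallyIntegrableOn measurableSet_Ioi)
    (htop (s.re + 1)) (lt_add_one _) (hbot (s.re - 1)) (sub_one_lt _)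

/-- `(∫_0^∞ g t^{s-1})' = ∫_0^∞ (log t) g t^{s-1}` as functions of `s`, in the decay class.
[cite: CremonaAlgorithms1997, §2.13] -/
theorem deriv_mellin_of_decay {g : ℝ → ℂ} (hg : ContinuousOn g (Ioi 0))
    (htop : ∀ a : ℝ, g =O[atTop] (· ^ (-a))) (hbot : ∀ b : ℝ, g =O[𝓝[>] 0] (· ^ (-b))) :
    deriv (mellin g) = mellin (fun t : ℝ ↦ Real.log t • g t) :=
  funext fun s ↦ (hasDerivAt_mellin_of_decay hg htop hbot s).2.deriv

/-- **"Differentiating `k` times with respect to `s`", `k = 3`**: in the decay class,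
`(d/ds)³ ∫_0^∞ g(t) t^{s-1} dt |_{s=1} = ∫_0^∞ g(t) (log t)³ dt`, and `g (log t)³` is integrable on
`(0, ∞)`. [cite: CremonaAlgorithms1997, §2.13] -/
theorem iteratedDeriv_three_mellin_one_of_decay {g : ℝ → ℂ} (hg : ContinuousOn g (Ioi 0))
    (htop : ∀ a : ℝ, g =O[atTop] (· ^ (-a))) (hbot : ∀ b : ℝ, g =O[𝓝[>] 0] (· ^ (-b))) :
    IntegrableOn (fun t : ℝ ↦ (Real.log t : ℂ) ^ 3 * g t) (Ioi 0) ∧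
      iteratedDeriv 3 (mellin g) 1 = ∫ t in Ioi (0 : ℝ), (Real.log t : ℂ) ^ 3 * g t := by
  obtain ⟨h1c, h1top, h1bot⟩ := decay_log_smul hg htop hbot
  obtain ⟨h2c, h2top, h2bot⟩ := decay_log_smul h1c h1top h1bot
  have hconv := (hasDerivAt_mellin_of_decay h2c h2top h2bot 1).1
  have h3 : (fun t : ℝ ↦ Real.log t • (Real.log t • (Real.log t • g t))) =
      fun t : ℝ ↦ (Real.log t : ℂ) ^ 3 * g t := by
    funext t
    simp only [Complex.real_smul]
    ring
  refine ⟨?_, ?_⟩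
  · unfold MellinConvergent at hconv
    refine (hconv.congr_fun (fun t _ ↦ ?_) measurableSet_Ioi)
    simp only [sub_self, Complex.cpow_zero, one_smul, Complex.real_smul]
    ring
  · rw [iteratedDeriv_succ', deriv_mellin_of_decay hg htop hbot, iteratedDeriv_succ',
      deriv_mellin_of_decay h1c h1top h1bot, iteratedDeriv_one,
      deriv_mellin_of_decay h2c h2top h2bot, h3]
    unfold mellin
    refine setIntegral_congr_fun measurableSet_Ioi fun t _ ↦ ?_
    simp only [sub_self, Complex.cpow_zero, one_smul]

/-! ### The rescaled restriction `F(y) = f(iy/√N)`: decay and the flip `F(1/y) = -y² F(y)` -/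

variable {N : ℕ} [NeZero N]

/-- The rescaled restriction `y ↦ f(icy)` (`c > 0`) of a cusp form on an arithmetic subgroup is in
the decay class: continuous on `(0, ∞)`, `O(y^{-a})` at `∞` (exponential decay,
`exists_isBigO_imagAxis_atTop`) and at `0⁺` (`isBigO_imagAxis_nhdsGT_zero`) for every `a`.
[cite: CremonaAlgorithms1997, §2.8 and §2.13] -/
theorem decay_imagAxis_rescaled {Γ : Subgroup (GL (Fin 2) ℝ)} [Γ.IsArithmetic] {k : ℤ}
    (f : CuspForm Γ k) {c : ℝ} (hc : 0 < c) :
    ContinuousOn (fun y : ℝ ↦ (fun t : ℝ ↦ f (ofComplex (Complex.I * t))) (c * y)) (Ioi 0) ∧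
      (∀ a : ℝ, (fun y : ℝ ↦ (fun t : ℝ ↦ f (ofComplex (Complex.I * t))) (c * y)) =O[atTop]
        (· ^ (-a))) ∧
      (∀ b : ℝ, (fun y : ℝ ↦ (fun t : ℝ ↦ f (ofComplex (Complex.I * t))) (c * y)) =O[𝓝[>] 0]
        (· ^ (-b))) := by
  have hmaps : MapsTo (fun y : ℝ ↦ c * y) (Ioi 0) (Ioi 0) := fun y hy ↦ mul_pos hc hy
  refine ⟨?_, fun a ↦ ?_, fun b ↦ ?_⟩
  · exact (continuousOn_imagAxis (CuspFormClass.holo f)).comp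
      (continuousOn_const.mul continuousOn_id) hmaps
  · obtain ⟨c', hc', htop⟩ := exists_isBigO_imagAxis_atTop f
    have ht : Tendsto (fun y : ℝ ↦ c * y) atTop atTop :=
      (tendsto_id.const_mul_atTop hc).congr fun x ↦ by simp
    have h1 := htop.comp_tendsto ht
    have h2 : ((fun t : ℝ ↦ Real.exp (-c' * t)) ∘ fun y : ℝ ↦ c * y) =
        fun y : ℝ ↦ Real.exp (-(c' * c) * y) := by
      funext y
      simp only [Function.comp]
      ring_nf
    rw [h2] at h1
    exact h1.trans (isLittleO_exp_neg_mul_rpow_atTop (mul_pos hc' hc) _).isBigO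
  · have htend : Tendsto (fun y : ℝ ↦ c * y) (𝓝[>] 0) (𝓝[>] 0) := by
      refine tendsto_nhdsWithin_iff.mpr ⟨?_, ?_⟩
      · have h : Tendsto (fun y : ℝ ↦ c * y) (𝓝 0) (𝓝 (c * 0)) :=
          (continuous_const.mul continuous_id).tendsto 0
        rw [mul_zero] at h
        exact h.mono_left nhdsWithin_le_nhds
      · filter_upwards [self_mem_nhdsWithin] with y hy using mul_pos hc hy
    have h1 := (isBigO_imagAxis_nhdsGT_zero f b).comp_tendsto htend
    refine h1.trans (IsBigO.of_bound (c ^ (-b)) ?_)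
    filter_upwards [self_mem_nhdsWithin] with y (hy : 0 < y)
    simp only [Function.comp, Real.norm_of_nonneg (Real.rpow_nonneg (mul_pos hc hy).le _),
      Real.norm_of_nonneg (Real.rpow_nonneg hy.le _)]
    rw [Real.mul_rpow hc.le hy.le]

/-- **The flip `F(1/y) = -y² F(y)`** for `F(y) = f(iy/√N)`, `w_N f = f`, `y > 0`: Cremona's "using
`f(-1/Nz) = ε N z² f(z)`" with `ε = +1` at `z = iy/√N` (tree lemma
`imagAxis_mul_inv_eq_of_frickeInvolution_eq` at `t = y/√N`, with `N · (y/√N) = √N y`).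
[cite: CremonaAlgorithms1997, §2.13] -/
theorem imagAxis_rescaled_inv_eq {f : CuspForm (Gamma0 N) 2}
    (hf : frickeInvolution N 2 f = f) {y : ℝ} (hy : 0 < y) :
    (fun t : ℝ ↦ f (ofComplex (Complex.I * t))) ((Real.sqrt N)⁻¹ * y⁻¹) =
      -(y : ℂ) ^ 2 * (fun t : ℝ ↦ f (ofComplex (Complex.I * t))) ((Real.sqrt N)⁻¹ * y) := by
  have hNpos : (0 : ℝ) < N := Nat.cast_pos.mpr (NeZero.pos N)
  have hsqrt : 0 < Real.sqrt N := Real.sqrt_pos.mpr hNpos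
  have ht : 0 < (Real.sqrt N)⁻¹ * y := mul_pos (inv_pos.mpr hsqrt) hy
  have h := imagAxis_mul_inv_eq_of_frickeInvolution_eq hf ht
  have h1 : ((N : ℝ) * ((Real.sqrt N)⁻¹ * y))⁻¹ = (Real.sqrt N)⁻¹ * y⁻¹ := by
    have hNs : (N : ℝ) * (Real.sqrt N)⁻¹ = Real.sqrt N := by
      rw [mul_inv_eq_iff_eq_mul₀ hsqrt.ne']
      exact (Real.mul_self_sqrt hNpos.le).symm
    rw [← mul_assoc, hNs, mul_inv]
  rw [h1] at h
  beta_reduce at h ⊢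
  rw [h]
  have hreal : (N : ℝ) * ((Real.sqrt N)⁻¹ * y) ^ 2 = y ^ 2 := by
    rw [mul_pow, inv_pow, Real.sq_sqrt hNpos.le]
    field_simp
  have hc : (N : ℂ) * (((Real.sqrt N)⁻¹ * y : ℝ) : ℂ) ^ 2 = (y : ℂ) ^ 2 := by
    exact_mod_cast hreal
  congr 1
  linear_combination -hc

/-- `(1/√N)^{-s} = N^{s/2}` in `ℂ` (`√N > 0`). [cite: CremonaAlgorithms1997, (2.8.5)] -/
theorem inv_sqrt_cpow_neg (s : ℂ) :
    (((Real.sqrt N)⁻¹ : ℝ) : ℂ) ^ (-s) = (N : ℂ) ^ (s / 2) := by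
  have hNpos : (0 : ℝ) < N := Nat.cast_pos.mpr (NeZero.pos N)
  have hsqrt : 0 < Real.sqrt N := Real.sqrt_pos.mpr hNpos
  have harg : ((Real.sqrt N : ℝ) : ℂ).arg ≠ Real.pi := by
    rw [Complex.arg_ofReal_of_nonneg hsqrt.le]
    exact Real.pi_pos.ne
  rw [Complex.ofReal_inv, Complex.inv_cpow _ _ harg, Complex.cpow_neg, inv_inv,
    Real.sqrt_eq_rpow, Complex.ofReal_cpow hNpos.le]
  push_cast
  rw [← Complex.cpow_mul]
  · congr 1
    ring
  · rw [show Complex.log (N : ℂ) = (Real.log N : ℂ) from (Complex.ofReal_log hNpos.le).symm]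
    simp only [← Complex.ofReal_ofNat, ← Complex.ofReal_one, ← Complex.ofReal_div,
      ← Complex.ofReal_mul, Complex.ofReal_im]
    exact neg_lt_zero.mpr Real.pi_pos
  · rw [show Complex.log (N : ℂ) = (Real.log N : ℂ) from (Complex.ofReal_log hNpos.le).symm]
    simp only [← Complex.ofReal_ofNat, ← Complex.ofReal_one, ← Complex.ofReal_div,
      ← Complex.ofReal_mul, Complex.ofReal_im]
    exact Real.pi_pos.le

/-- **`Λ(f, s) = ∫_0^∞ f(iy/√N) y^{s-1} dy`** ([CremonaAlgorithms1997] (2.8.5), "putting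
`y = √N t`"): every entire continuation `Λ` of `Λ_N(f, s)` is the Mellin transform of
`F(y) = f(iy/√N)` — Hecke's `N^{s/2} ∫_0^∞ f(it) t^{s-1} dt`
(`cpow_mul_mellin_mem_completedCuspFormLContinuations_two`, uniqueness of the continuation) and
Mathlib `mellin_comp_mul_left`. [cite: CremonaAlgorithms1997, (2.8.5)] -/
theorem completedCuspFormL_continuation_eq_mellin_rescaled {f : CuspForm (Gamma0 N) 2}
    {Λ : ℂ → ℂ} (hΛ : Λ ∈ completedCuspFormLContinuations N f) :
    Λ = mellin (fun y : ℝ ↦ (fun t : ℝ ↦ f (ofComplex (Complex.I * t))) ((Real.sqrt N)⁻¹ * y)) := by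
  have hsqrt : 0 < (Real.sqrt N)⁻¹ :=
    inv_pos.mpr (Real.sqrt_pos.mpr (Nat.cast_pos.mpr (NeZero.pos N)))
  have heq : Λ = fun s ↦ (N : ℂ) ^ (s / 2) * mellin (fun t : ℝ ↦ f (ofComplex (Complex.I * t))) s :=
    subsingleton_completedCuspFormLContinuations N f hΛ
      (cpow_mul_mellin_mem_completedCuspFormLContinuations_two f)
  rw [heq]
  funext s
  rw [mellin_comp_mul_left (fun t : ℝ ↦ f (ofComplex (Complex.I * t))) s hsqrt, smul_eq_mul,
    inv_sqrt_cpow_neg]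

/-! ### `Λ‴(f, 1) = 2 ∫_1^∞ f(iy/√N) (log y)³ dy` -/

/-- **Cremona (2.13.1), `r = 3`, as an integral**: for `f ∈ S₂(Γ₀(N))` with `w_N f = f` and `Λ` the
entire continuation of `Λ_N(f, s)`, `Λ‴(f, 1) = 2 ∫_1^∞ f(iy/√N) (log y)³ dy`
("`Λ^{(k)}(f, 1) = (1 - (-1)^k ε) ∫_1^∞ f(iy/√N)(log y)^k dy`" with `k = 3`, `ε = +1`): differentiate
`Λ(s) = ∫_0^∞ F(y) y^{s-1} dy` three times under the integral
(`iteratedDeriv_three_mellin_one_of_decay`), then fold `(0, 1]` onto `[1, ∞)` by `y ↦ 1/y` using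
`F(1/y) = -y² F(y)` and `(log (1/y))³ = -(log y)³` (`setIntegral_Ioc_eq_of_flip`).
[cite: CremonaAlgorithms1997, (2.13.1)] -/
theorem iteratedDeriv_three_completedCuspFormL_continuation_one_eq_integral
    {f : CuspForm (Gamma0 N) 2} (hf : frickeInvolution N 2 f = f) {Λ : ℂ → ℂ}
    (hΛ : Λ ∈ completedCuspFormLContinuations N f) :
    iteratedDeriv 3 Λ 1 = 2 * ∫ y in Ioi (1 : ℝ),
      (Real.log y : ℂ) ^ 3 * (fun t : ℝ ↦ f (ofComplex (Complex.I * t))) ((Real.sqrt N)⁻¹ * y) := by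
  have hsqrt : 0 < (Real.sqrt N)⁻¹ :=
    inv_pos.mpr (Real.sqrt_pos.mpr (Nat.cast_pos.mpr (NeZero.pos N)))
  set F : ℝ → ℂ := fun y : ℝ ↦ (fun t : ℝ ↦ f (ofComplex (Complex.I * t))) ((Real.sqrt N)⁻¹ * y)
    with hF
  obtain ⟨hc, htop, hbot⟩ := decay_imagAxis_rescaled f hsqrt
  obtain ⟨hint, h3⟩ := iteratedDeriv_three_mellin_one_of_decay hc htop hbot
  rw [completedCuspFormL_continuation_eq_mellin_rescaled hΛ, h3]
  -- the weighted integrand `Φ(y) = (log y)³ F(y)` and its flip symmetry `Φ(y) = y⁻² Φ(1/y)`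
  set Φ : ℝ → ℂ := fun y ↦ (Real.log y : ℂ) ^ 3 * F y with hΦ
  have hFinv : ∀ y : ℝ, 0 < y → F y⁻¹ = -(y : ℂ) ^ 2 * F y := fun y hy ↦ by
    simp only [hF]
    exact imagAxis_rescaled_inv_eq hf hy
  have hflipΦ : ∀ y : ℝ, 0 < y → Φ y = (1 : ℂ) / ((1 : ℝ) * y ^ 2 : ℝ) * Φ (1 / ((1 : ℝ) * y)) := by
    intro y hy
    have hy0 : (y : ℂ) ≠ 0 := Complex.ofReal_ne_zero.mpr hy.ne'
    have hΦy : Φ y = (Real.log y : ℂ) ^ 3 * F y := rfl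
    have hΦy' : Φ (1 / ((1 : ℝ) * y)) = (Real.log y⁻¹ : ℂ) ^ 3 * F y⁻¹ := by
      simp only [hΦ, one_mul, one_div]
    rw [hΦy, hΦy', Real.log_inv, hFinv y hy]
    push_cast
    field_simp
  -- split `(0, ∞) = (0, 1] ∪ (1, ∞)` and flip the first piece
  have hsplit : ∫ y in Ioi (0 : ℝ), Φ y = (∫ y in Ioc 0 1, Φ y) + ∫ y in Ioi 1, Φ y := by
    rw [← Ioc_union_Ioi_eq_Ioi zero_le_one, setIntegral_union (Ioc_disjoint_Ioi le_rfl)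
      measurableSet_Ioi (hint.mono_set Ioc_subset_Ioi_self)
      (hint.mono_set (Ioi_subset_Ioi zero_le_one))]
  have hflip : ∫ y in Ioc (0 : ℝ) 1, Φ y = ∫ y in Ioi 1, Φ y := by
    rw [setIntegral_Ioc_eq_of_flip one_pos one_pos hflipΦ]
    simp
  change ∫ y in Ioi (0 : ℝ), Φ y = 2 * ∫ y in Ioi 1, Φ y
  rw [hsplit, hflip]
  ring

/-! ### Termwise integration against `(log y)³`: (2.13.1), second equality, `r = 3` -/

/-- Pointwise majorant: for `β > 0` and `v > 1`, `|e^{-βv} (log v)³| ≤ (48/β³) e^{-(β/2) v}`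
(`0 ≤ log v ≤ v` and `v³ ≤ 3! (2/β)³ e^{βv/2}`, Mathlib `Real.pow_div_factorial_le_exp`) — the
domination behind the termwise integration in (2.13.1), `r = 3`. [cite: CremonaAlgorithms1997, §2.13 (2.13.1)] -/
theorem norm_exp_neg_mul_mul_log_pow_three_le {β : ℝ} (hβ : 0 < β) {v : ℝ} (hv : 1 < v) :
    ‖Real.exp (-(β * v)) * Real.log v ^ 3‖ ≤ 24 / β ^ 2 * (2 / β * Real.exp (-(β / 2 * v))) := by
  have hv0 : 0 < v := by linarith
  have hlog0 : 0 ≤ Real.log v := Real.log_nonneg hv.le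
  have hlogv : Real.log v ≤ v := (Real.log_le_sub_one_of_pos hv0).trans (by linarith)
  have hl3 : Real.log v ^ 3 ≤ v ^ 3 := pow_le_pow_left₀ hlog0 hlogv 3
  have hy : 0 ≤ β * v / 2 := by positivity
  have hexp : (β * v / 2) ^ 3 / (Nat.factorial 3) ≤ Real.exp (β * v / 2) :=
    Real.pow_div_factorial_le_exp _ hy 3
  rw [show (Nat.factorial 3 : ℝ) = 6 by norm_num] at hexp
  have hv3 : v ^ 3 ≤ 48 / β ^ 3 * Real.exp (β * v / 2) := by
    have hb3 : 0 < β ^ 3 := by positivity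
    rw [div_mul_eq_mul_div, le_div_iff₀ hb3]
    have : (β * v / 2) ^ 3 = β ^ 3 * v ^ 3 / 8 := by ring
    rw [this] at hexp
    nlinarith [Real.exp_pos (β * v / 2)]
  rw [Real.norm_of_nonneg (mul_nonneg (Real.exp_pos _).le (pow_nonneg hlog0 3))]
  calc Real.exp (-(β * v)) * Real.log v ^ 3
      ≤ Real.exp (-(β * v)) * v ^ 3 := mul_le_mul_of_nonneg_left hl3 (Real.exp_pos _).le
    _ ≤ Real.exp (-(β * v)) * (48 / β ^ 3 * Real.exp (β * v / 2)) :=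
        mul_le_mul_of_nonneg_left hv3 (Real.exp_pos _).le
    _ = 24 / β ^ 2 * (2 / β * Real.exp (-(β / 2 * v))) := by
        have hβ0 : β ≠ 0 := hβ.ne'
        rw [show Real.exp (-(β * v)) * (48 / β ^ 3 * Real.exp (β * v / 2)) =
          48 / β ^ 3 * (Real.exp (-(β * v)) * Real.exp (β * v / 2)) by ring, ← Real.exp_add,
          show -(β * v) + β * v / 2 = -(β / 2 * v) by ring]
        field_simp
        ring

/-- `e^{-βv} (log v)³` is integrable on `(1, ∞)` for `β > 0`, and
`∫_1^∞ |e^{-βv} (log v)³| dv ≤ 96 e^{-β/2}/β⁴` (the weights of (2.13.1), `r = 3`, and their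
domination). [cite: CremonaAlgorithms1997, §2.13 (2.13.1)] -/
theorem integrableOn_exp_neg_mul_mul_log_pow_three {β : ℝ} (hβ : 0 < β) :
    IntegrableOn (fun v : ℝ ↦ Real.exp (-(β * v)) * Real.log v ^ 3) (Ioi 1) ∧
      ∫ v in Ioi (1 : ℝ), ‖Real.exp (-(β * v)) * Real.log v ^ 3‖ ≤
        24 / β ^ 2 * (4 * Real.exp (-(β / 2)) / β ^ 2) := by
  obtain ⟨hm_int, hm_val⟩ := integral_majorant_exp hβ
  have hbound : ∀ᵐ v ∂(volume.restrict (Ioi (1 : ℝ))),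
      ‖Real.exp (-(β * v)) * Real.log v ^ 3‖ ≤ 24 / β ^ 2 * (2 / β * Real.exp (-(β / 2 * v))) :=
    (ae_restrict_iff' measurableSet_Ioi).mpr (Eventually.of_forall fun v hv ↦
      norm_exp_neg_mul_mul_log_pow_three_le hβ hv)
  have hmeas : AEStronglyMeasurable (fun v : ℝ ↦ Real.exp (-(β * v)) * Real.log v ^ 3)
      (volume.restrict (Ioi (1 : ℝ))) := by
    refine ContinuousOn.aestronglyMeasurable ?_ measurableSet_Ioi
    exact (Continuous.continuousOn (by fun_prop)).mul
      ((Real.continuousOn_log.mono fun v (hv : 1 < v) ↦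
        ne_of_gt (show (0 : ℝ) < v by linarith)).pow 3)
  refine ⟨Integrable.mono' (hm_int.const_mul _) hmeas hbound, ?_⟩
  rw [← hm_val, ← integral_const_mul]
  exact integral_mono_of_nonneg (Eventually.of_forall fun v ↦ norm_nonneg _)
    (hm_int.const_mul _) hbound

/-- **Termwise integration of the `q`-expansion against `(log y)³`**: for a cusp form `g = ∑ aₙ qⁿ`
(`1` a strict period) and `c > 0`,
`∫_1^∞ g(icy) (log y)³ dy = ∑_{n ≥ 1} aₙ ∫_1^∞ e^{-2πncy} (log y)³ dy`, dominated by
`∑ ‖aₙ‖ · 96 e^{-πnc}/(2πnc)⁴ < ∞` ([CremonaAlgorithms1997], (2.13.1), second equality: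
"`= 2 ∑ a(n, f) ∫_1^∞ exp(-2πny/√N)(log y)^r dy`", `r = 3`, `c = 1/√N`).
[cite: CremonaAlgorithms1997, (2.13.1)] -/
theorem hasSum_integral_Ioi_one_log_pow_three_mul_imagAxis {Γ : Subgroup (GL (Fin 2) ℝ)} {k : ℤ}
    (hΓ : (1 : ℝ) ∈ Γ.strictPeriods) (g : CuspForm Γ k) {c : ℝ} (hc : 0 < c) :
    HasSum (fun n : ℕ ↦ cuspCoeff g n *
        ((∫ v in Ioi (1 : ℝ), Real.exp (-(2 * Real.pi * n * c * v)) * Real.log v ^ 3 : ℝ) : ℂ))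
      (∫ v in Ioi (1 : ℝ),
        (Real.log v : ℂ) ^ 3 * (fun t : ℝ ↦ g (ofComplex (Complex.I * t))) (c * v)) := by
  have h0 : cuspCoeff g 0 = 0 := cuspCoeff_zero hΓ g
  have hβ : ∀ n : ℕ, 0 < n → 0 < 2 * Real.pi * n * c := fun n hn ↦ by positivity
  set F : ℕ → ℝ → ℂ := fun n v ↦ cuspCoeff g n *
    ((Real.exp (-(2 * Real.pi * n * c * v)) * Real.log v ^ 3 : ℝ) : ℂ) with hF
  have hF_int : ∀ n : ℕ, Integrable (F n) (volume.restrict (Ioi 1)) := by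
    intro n
    rcases Nat.eq_zero_or_pos n with rfl | hn
    · simp only [hF, h0, zero_mul]
      exact integrable_zero _ _ _
    · exact ((integrableOn_exp_neg_mul_mul_log_pow_three (hβ n hn)).1.ofReal).const_mul _
  have hF_val : ∀ n : ℕ, ∫ v in Ioi (1 : ℝ), F n v = cuspCoeff g n *
      ((∫ v in Ioi (1 : ℝ), Real.exp (-(2 * Real.pi * n * c * v)) * Real.log v ^ 3 : ℝ) : ℂ) := by
    intro n
    simp only [hF]
    rw [integral_const_mul, integral_complex_ofReal]
  -- domination: `∫ ‖F n‖ ≤ ‖aₙ‖ · 96 e^{-πnc}/(2πnc)⁴ ≤ (48/(π³ c⁴)) · ‖aₙ‖ e^{-2πn(c/2)}/(2πn)`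
  set T : ℕ → ℝ := fun n ↦ ‖cuspCoeff g n‖ *
    (Real.exp (-(2 * Real.pi * n) * (c / 2)) / (2 * Real.pi * n)) with hT
  have hTsum : Summable T := summable_norm_cuspCoeff_mul_exp_div hΓ g (half_pos hc)
  have hle : ∀ n : ℕ, ∫ v in Ioi (1 : ℝ), ‖F n v‖ ≤ 12 / (Real.pi ^ 3 * c ^ 4) * T n := by
    intro n
    rcases Nat.eq_zero_or_pos n with rfl | hn
    · simp [hF, hT, h0]
    · obtain ⟨hm_int, hm_val⟩ := integral_majorant_exp (hβ n hn)
      have h1 : ∫ v in Ioi (1 : ℝ), ‖F n v‖ ≤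
          ∫ v in Ioi (1 : ℝ), ‖cuspCoeff g n‖ * (24 / (2 * Real.pi * n * c) ^ 2 *
            (2 / (2 * Real.pi * n * c) * Real.exp (-(2 * Real.pi * n * c / 2 * v)))) := by
        refine integral_mono_of_nonneg (Eventually.of_forall fun v ↦ norm_nonneg _)
          ((hm_int.const_mul _).const_mul _) ((ae_restrict_iff' measurableSet_Ioi).mpr
            (Eventually.of_forall fun v hv ↦ ?_))
        simp only [hF]
        rw [norm_mul, Complex.norm_real]
        exact mul_le_mul_of_nonneg_left (norm_exp_neg_mul_mul_log_pow_three_le (hβ n hn) hv)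
          (norm_nonneg _)
      rw [integral_const_mul, integral_const_mul, hm_val,
        show -(2 * Real.pi * n * c / 2) = -(2 * Real.pi * n) * (c / 2) by ring] at h1
      refine h1.trans ?_
      set E : ℝ := Real.exp (-(2 * Real.pi * n) * (c / 2)) with hE_def
      have hE : 0 ≤ ‖cuspCoeff g n‖ * E := by positivity
      have hn1 : (1 : ℝ) ≤ n := by exact_mod_cast hn
      have hfac : 24 / (2 * Real.pi * n * c) ^ 2 * (4 / (2 * Real.pi * n * c) ^ 2) ≤
          12 / (Real.pi ^ 3 * c ^ 4) / (2 * Real.pi * n) := by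
        rw [div_mul_div_comm, div_div, div_le_div_iff₀ (by positivity) (by positivity)]
        have hid : 12 * ((2 * Real.pi * n * c) ^ 2 * (2 * Real.pi * n * c) ^ 2) -
            24 * 4 * (Real.pi ^ 3 * c ^ 4 * (2 * Real.pi * n)) =
            192 * Real.pi ^ 4 * c ^ 4 * n * (n ^ 3 - 1) := by ring
        have hn3 : (0 : ℝ) ≤ n ^ 3 - 1 := by
          have := one_le_pow₀ (M₀ := ℝ) hn1 (n := 3)
          linarith
        have hnn : 0 ≤ 192 * Real.pi ^ 4 * c ^ 4 * n * (n ^ 3 - 1) :=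
          mul_nonneg (by positivity) hn3
        linarith
      calc ‖cuspCoeff g n‖ * (24 / (2 * Real.pi * n * c) ^ 2 *
            (4 * E / (2 * Real.pi * n * c) ^ 2))
          = ‖cuspCoeff g n‖ * E * (24 / (2 * Real.pi * n * c) ^ 2 *
              (4 / (2 * Real.pi * n * c) ^ 2)) := by ring
        _ ≤ ‖cuspCoeff g n‖ * E * (12 / (Real.pi ^ 3 * c ^ 4) / (2 * Real.pi * n)) :=
          mul_le_mul_of_nonneg_left hfac hE
        _ = 12 / (Real.pi ^ 3 * c ^ 4) * T n := by simp only [hT]; ring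
  have hsum : Summable fun n : ℕ ↦ ∫ v in Ioi (1 : ℝ), ‖F n v‖ :=
    Summable.of_nonneg_of_le (fun n ↦ integral_nonneg fun v ↦ norm_nonneg _) hle
      (hTsum.mul_left _)
  have hmain := hasSum_integral_of_summable_integral_norm hF_int hsum
  simp_rw [hF_val] at hmain
  have heq : ∫ v in Ioi (1 : ℝ), (∑' n : ℕ, F n v) =
      ∫ v in Ioi (1 : ℝ),
        (Real.log v : ℂ) ^ 3 * (fun t : ℝ ↦ g (ofComplex (Complex.I * t))) (c * v) := by
    refine setIntegral_congr_fun measurableSet_Ioi fun v hv ↦ ?_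
    have hcv : 0 < c * v := mul_pos hc (zero_lt_one.trans hv)
    have hs := (hasSum_imagAxis hΓ g hcv).mul_left ((Real.log v : ℂ) ^ 3)
    rw [← hs.tsum_eq]
    congr 1
    funext n
    simp only [hF]
    push_cast
    ring_nf
  rwa [heq] at hmain

/-- **Cremona (2.13.1), `r = 3`** (Buhler–Gross–Zagier): for `f = ∑ aₙ qⁿ ∈ S₂(Γ₀(N))` with
`w_N f = f` and `Λ` the entire continuation of `Λ_N(f, s)`,
`Λ‴(f, 1) = 2 ∑_{n ≥ 1} aₙ ∫_1^∞ e^{-2πny/√N} (log y)³ dy`. [cite: CremonaAlgorithms1997, (2.13.1)]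
[cite: BuhlerGrossZagier1985, §3 (11)–(13)] -/
theorem hasSum_iteratedDeriv_three_completedCuspFormL_continuation_one_integral
    {f : CuspForm (Gamma0 N) 2} (hf : frickeInvolution N 2 f = f) {Λ : ℂ → ℂ}
    (hΛ : Λ ∈ completedCuspFormLContinuations N f) :
    HasSum (fun n : ℕ ↦ 2 * (cuspCoeff f n *
        ((∫ v in Ioi (1 : ℝ),
          Real.exp (-(2 * Real.pi * n * (Real.sqrt N)⁻¹ * v)) * Real.log v ^ 3 : ℝ) : ℂ)))
      (iteratedDeriv 3 Λ 1) := by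
  have ht₀ : 0 < (Real.sqrt N)⁻¹ :=
    inv_pos.mpr (Real.sqrt_pos.mpr (Nat.cast_pos.mpr (NeZero.pos N)))
  rw [iteratedDeriv_three_completedCuspFormL_continuation_one_eq_integral hf hΛ]
  exact (hasSum_integral_Ioi_one_log_pow_three_mul_imagAxis one_mem_strictPeriods_Gamma0 f
    ht₀).mul_left 2

end Literature.NumberTheory.EllipticCurves.ModularForms

end
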